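import Literature.Analysis.FluidPDE.TypeIAncientMild
import Literature.Analysis.FluidPDE.SpaceTimeRescaling
import Mathlib.Analysis.SpecialFunctions.Gaussian.FourierTransform
import Mathlib.MeasureTheory.Integral.DominatedConvergence
import Mathlib.Analysis.Calculus.IteratedDeriv.Lemmas
import Mathlib.Analysis.Calculus.MeanValue
import HarnessLib

/-!
# Crux `ClockStretchingLaw.ClockLaw` (stmt-NavierStokesRegularity-10571), line `birth`:
# stub `stub_clockSlice` — clock calculus on slices

For a Type-I KNSS-mild ancient field `u` (`IsTypeIAncientMild C u`) the **clock amplitude** is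
`a_u(t) = (−t)^{3/2} ∫ ‖∂ₜu(t,x)‖² e^{−‖x‖²/(4(−t))} dx`. GIVEN universal window bounds on `∂ₜu`,
`∂ₜ²u` for the class (the skeleton's `TimeDerivBounds`, a hypothesis here) we prove: (i) continuity
of `a_u` on `(−∞, 0)` (continuity under the integral, Gaussian majorant on a window `[a, b] ∋ t`);
(ii) `a_u(t₀) = 0`, `t₀ < 0`, forces `∂ₜu(t₀, ·) ≡ 0` (continuous nonnegative integrable integrand);
(iii) `a_{w_j}(t) → a_W(t)` when `w_j → W` pointwise inside the class with one constant (the `∂ₜ²`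
bound upgrades pointwise convergence to convergence of `∂ₜ`; dominated convergence) — (i)–(iii) on
any finite-dimensional inner product space; (iv) on `ℝ³`, the covariance `a_{u_c}(s) = a_u(c² s)`
under the zoom `u_c(s,y) = c u(c²s, cy)` (chain rule, substitution `x = c y`).
-/

noncomputable section

namespace Summit.NavierStokesRegularity.NavierStokesRegularity.Theorems.ClockLaw.Birth

open MeasureTheory Filter Topology Set Metric Function
open Literature.Analysis Literature.Analysis.FluidPDE
open scoped Topology NNReal ENNReal InnerProductSpace

-- Summit = Problem namespace duplication is the tree's layout (CONVENTIONS §1); as in every Theorems file.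
set_option linter.dupNamespace false

variable {E : Type*} [NormedAddCommGroup E]

/-- Monotonicity of the majorant: for `a ≤ t < 0` and `‖v‖ ≤ K`,
`‖v‖² e^{−‖x‖²/(4(−t))} ≤ K² e^{−‖x‖²/(4(−a))}`. -/
private theorem sq_mul_clockWeight_le {K a t : ℝ} (hat : a ≤ t) (ht : t < 0) {v : E} (hv : ‖v‖ ≤ K)
    (x : E) :
    ‖v‖ ^ 2 * Real.exp (-(‖x‖ ^ 2) / (4 * -t)) ≤ K ^ 2 * Real.exp (-(‖x‖ ^ 2) / (4 * -a)) := by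
  have h1 : ‖v‖ ^ 2 ≤ K ^ 2 := pow_le_pow_left₀ (norm_nonneg _) hv 2
  have h2 : Real.exp (-(‖x‖ ^ 2) / (4 * -t)) ≤ Real.exp (-(‖x‖ ^ 2) / (4 * -a)) := by
    refine Real.exp_le_exp.2 ?_
    rw [neg_div, neg_div, neg_le_neg_iff]
    exact div_le_div_of_nonneg_left (sq_nonneg _) (by linarith) (by linarith)
  exact mul_le_mul h1 h2 (Real.exp_pos _).le (sq_nonneg _)

variable [InnerProductSpace ℝ E] {u : ℝ → E → E}

/-- On the open slab, `∂ₜu(t,x)` is the Fréchet derivative of `uncurry u` at `(t,x)` applied to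
`(1, 0)` (chain rule along `s ↦ (s, x)`). -/
private theorem timeDeriv_eq_fderiv (hsm : ContDiffOn ℝ (⊤ : ℕ∞) (uncurry u) (Iio 0 ×ˢ univ))
    {t : ℝ} (ht : t < 0) (x : E) :
    timeDeriv u t x = fderiv ℝ (uncurry u) (t, x) ((1 : ℝ), (0 : E)) := by
  have hdiff : DifferentiableAt ℝ (uncurry u) (t, x) :=
    (hsm.differentiableOn (by simp)).differentiableAt
      ((isOpen_Iio.prod isOpen_univ).mem_nhds (mk_mem_prod ht (mem_univ _)))
  rw [timeDeriv_apply]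
  exact (hdiff.hasFDerivAt.comp_hasDerivAt t
    ((hasDerivAt_id t).prodMk (hasDerivAt_const t x))).deriv

/-- `(t, x) ↦ D(uncurry u)(t,x)(1,0)` is continuous on the open slab. -/
private theorem continuousOn_fderiv_uncurry
    (hsm : ContDiffOn ℝ (⊤ : ℕ∞) (uncurry u) (Iio 0 ×ˢ univ)) :
    ContinuousOn (fun p : ℝ × E => fderiv ℝ (uncurry u) p ((1 : ℝ), (0 : E))) (Iio 0 ×ˢ univ) :=
  (hsm.continuousOn_fderiv_of_isOpen (isOpen_Iio.prod isOpen_univ)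
    (by exact_mod_cast le_top)).clm_apply continuousOn_const

/-- The slice `x ↦ ∂ₜu(t, x)`, `t < 0`, is continuous. -/
private theorem continuous_timeDeriv_slice
    (hsm : ContDiffOn ℝ (⊤ : ℕ∞) (uncurry u) (Iio 0 ×ˢ univ)) {t : ℝ} (ht : t < 0) :
    Continuous fun x => timeDeriv u t x := by
  have hc := (continuousOn_fderiv_uncurry hsm).comp_continuous
    (f := fun y : E => ((t, y) : ℝ × E)) (by fun_prop) fun y => mk_mem_prod ht (mem_univ _)
  exact hc.congr fun y => (timeDeriv_eq_fderiv hsm ht y).symm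

/-- The curve `s ↦ ∂ₜu(s, x)` is continuous at every `t < 0`. -/
private theorem continuousAt_timeDeriv_curve
    (hsm : ContDiffOn ℝ (⊤ : ℕ∞) (uncurry u) (Iio 0 ×ˢ univ)) {t : ℝ} (ht : t < 0) (x : E) :
    ContinuousAt (fun s => timeDeriv u s x) t := by
  have hc : ContinuousOn (fun s : ℝ => fderiv ℝ (uncurry u) (s, x) ((1 : ℝ), (0 : E))) (Iio 0) :=
    (continuousOn_fderiv_uncurry hsm).comp
      (by fun_prop : Continuous fun s : ℝ => ((s, x) : ℝ × E)).continuousOn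
      fun s hs => mk_mem_prod hs (mem_univ _)
  refine (hc.continuousAt (isOpen_Iio.mem_nhds ht)).congr ?_
  filter_upwards [isOpen_Iio.mem_nhds ht] with s hs
  exact (timeDeriv_eq_fderiv hsm hs x).symm

/-- The clock integrand `x ↦ ‖∂ₜu(t,x)‖² e^{−‖x‖²/(4σ)}` of a slice `t < 0` is continuous. -/
private theorem continuous_clockIntegrand
    (hsm : ContDiffOn ℝ (⊤ : ℕ∞) (uncurry u) (Iio 0 ×ˢ univ)) {t : ℝ} (ht : t < 0) (σ : ℝ) :
    Continuous fun x : E => ‖timeDeriv u t x‖ ^ 2 * Real.exp (-(‖x‖ ^ 2) / (4 * σ)) :=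
  ((continuous_timeDeriv_slice hsm ht).norm.pow 2).mul (Real.continuous_exp.comp (by fun_prop))

/-- The time curves `t ↦ u(t,x)` are smooth on `(−∞, 0)`. -/
private theorem contDiffOn_curve (hsm : ContDiffOn ℝ (⊤ : ℕ∞) (uncurry u) (Iio 0 ×ˢ univ))
    (x : E) : ContDiffOn ℝ (⊤ : ℕ∞) (fun t => u t x) (Iio 0) :=
  hsm.comp (contDiffOn_id.prodMk contDiffOn_const) fun _ ht => mk_mem_prod ht (mem_univ _)

/-- Derivatives of the time curves at `t < 0` (twin of the tree's `steadySlice_hasDerivAt_curve`,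
`ClockStretchingLawSteadySliceLiouvilleAnalytic.lean`, not imported to keep the closure small). -/
private theorem hasDerivAt_curve (hsm : ContDiffOn ℝ (⊤ : ℕ∞) (uncurry u) (Iio 0 ×ˢ univ))
    (x : E) {t : ℝ} (ht : t < 0) :
    HasDerivAt (fun τ => u τ x) (deriv (fun τ => u τ x) t) t ∧
      HasDerivAt (deriv fun τ => u τ x) (iteratedDeriv 2 (fun τ => u τ x) t) t := by
  have hcd := contDiffOn_curve hsm x
  have hd1 : DifferentiableOn ℝ (fun τ => u τ x) (Iio 0) := hcd.differentiableOn (by simp)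
  have hcd' : ContDiffOn ℝ (⊤ : ℕ∞) (deriv fun τ => u τ x) (Iio 0) :=
    hcd.deriv_of_isOpen isOpen_Iio (by exact_mod_cast le_top)
  have hd2 : DifferentiableOn ℝ (deriv fun τ => u τ x) (Iio 0) := hcd'.differentiableOn (by simp)
  refine ⟨((hd1 t ht).differentiableAt (isOpen_Iio.mem_nhds ht)).hasDerivAt, ?_⟩
  have h2 := ((hd2 t ht).differentiableAt (isOpen_Iio.mem_nhds ht)).hasDerivAt
  rwa [show deriv (deriv fun τ => u τ x) t = iteratedDeriv 2 (fun τ => u τ x) t by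
    rw [iteratedDeriv_succ, iteratedDeriv_one]] at h2

variable {F : Type*} [NormedAddCommGroup F] [NormedSpace ℝ F]

/-- Taylor bound: if `‖φ''‖ ≤ K` on `[t, t+h]` then `‖(φ(t+h) − φ(t))/h − φ'(t)‖ ≤ K h`. -/
private theorem norm_slope_sub_deriv_le {φ : ℝ → F} {t h K : ℝ} (hh : 0 < h)
    (hd : ∀ s ∈ Icc t (t + h),
      HasDerivAt φ (deriv φ s) s ∧ HasDerivAt (deriv φ) (iteratedDeriv 2 φ s) s)
    (hK : ∀ s ∈ Icc t (t + h), ‖iteratedDeriv 2 φ s‖ ≤ K) :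
    ‖h⁻¹ • (φ (t + h) - φ t) - deriv φ t‖ ≤ K * h := by
  have hK0 : 0 ≤ K := (norm_nonneg _).trans (hK t ⟨le_rfl, by linarith⟩)
  -- the first derivative moves by at most `K (s - t)`
  have hA : ∀ s ∈ Icc t (t + h), ‖deriv φ s - deriv φ t‖ ≤ K * (s - t) :=
    norm_image_sub_le_of_norm_deriv_le_segment' (f := deriv φ) (f' := iteratedDeriv 2 φ)
      (fun s hs => (hd s hs).2.hasDerivWithinAt) (fun s hs => hK s (Ico_subset_Icc_self hs))
  -- hence `φ(s) - s • φ'(t)` moves by at most `K h (s - t)`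
  have hB : ∀ s ∈ Icc t (t + h),
      ‖(φ s - s • deriv φ t) - (φ t - t • deriv φ t)‖ ≤ K * h * (s - t) := by
    refine norm_image_sub_le_of_norm_deriv_le_segment' (f := fun s => φ s - s • deriv φ t)
      (f' := fun s => deriv φ s - deriv φ t) (fun s hs => ?_) (fun s hs => ?_)
    · have hl : HasDerivAt (fun r : ℝ => r • deriv φ t) (deriv φ t) s := by
        simpa using (hasDerivAt_id s).smul_const (deriv φ t)
      exact ((hd s hs).1.sub hl).hasDerivWithinAt
    · calc ‖deriv φ s - deriv φ t‖ ≤ K * (s - t) := hA s (Ico_subset_Icc_self hs)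
        _ ≤ K * h := by gcongr; linarith [hs.2]
  have hBh := hB (t + h) ⟨by linarith, le_rfl⟩
  have e : (φ (t + h) - (t + h) • deriv φ t) - (φ t - t • deriv φ t) =
      h • (h⁻¹ • (φ (t + h) - φ t) - deriv φ t) := by
    rw [smul_sub, smul_smul, mul_inv_cancel₀ hh.ne', one_smul, add_smul]
    abel
  rw [e, norm_smul, Real.norm_of_nonneg hh.le, add_sub_cancel_left] at hBh
  exact le_of_mul_le_mul_left (hBh.trans_eq (by ring)) hh

/-- If `φ_j → ψ` pointwise on `[t, t+η]` and all second derivatives are bounded by `K` there, then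
`φ_j'(t) → ψ'(t)` (difference quotients with a fixed small step, `ε/3` argument). -/
private theorem tendsto_deriv_of_tendsto {φ : ℕ → ℝ → F} {ψ : ℝ → F} {t η K : ℝ} (hη : 0 < η)
    (hdφ : ∀ j, ∀ s ∈ Icc t (t + η),
      HasDerivAt (φ j) (deriv (φ j) s) s ∧ HasDerivAt (deriv (φ j)) (iteratedDeriv 2 (φ j) s) s)
    (hdψ : ∀ s ∈ Icc t (t + η),
      HasDerivAt ψ (deriv ψ s) s ∧ HasDerivAt (deriv ψ) (iteratedDeriv 2 ψ s) s)
    (hKφ : ∀ j, ∀ s ∈ Icc t (t + η), ‖iteratedDeriv 2 (φ j) s‖ ≤ K)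
    (hKψ : ∀ s ∈ Icc t (t + η), ‖iteratedDeriv 2 ψ s‖ ≤ K)
    (hlim : ∀ s ∈ Icc t (t + η), Tendsto (fun j => φ j s) atTop (𝓝 (ψ s))) :
    Tendsto (fun j => deriv (φ j) t) atTop (𝓝 (deriv ψ t)) := by
  have hK0 : 0 ≤ K := (norm_nonneg _).trans (hKψ t ⟨le_rfl, by linarith⟩)
  rw [Metric.tendsto_atTop]
  intro ε hε
  -- a step `h ≤ η` with `K h < ε / 3`
  obtain ⟨h, hh0, hhη, hKh⟩ : ∃ h : ℝ, 0 < h ∧ h ≤ η ∧ K * h < ε / 3 := by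
    have hpos : 0 < 3 * K + 3 := by positivity
    refine ⟨min η (ε / (3 * K + 3)), lt_min hη (by positivity), min_le_left _ _, ?_⟩
    calc K * min η (ε / (3 * K + 3)) ≤ K * (ε / (3 * K + 3)) := by
          gcongr; exact min_le_right _ _
      _ < ε / 3 := by rw [mul_div_assoc', div_lt_div_iff₀ hpos three_pos]; nlinarith
  -- the difference quotients with step `h` converge
  have hslope : Tendsto (fun j => h⁻¹ • (φ j (t + h) - φ j t)) atTop
      (𝓝 (h⁻¹ • (ψ (t + h) - ψ t))) :=
    ((hlim (t + h) ⟨by linarith, by linarith⟩).sub (hlim t ⟨le_rfl, by linarith⟩)).const_smul h⁻¹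
  rw [Metric.tendsto_atTop] at hslope
  obtain ⟨N, hN⟩ := hslope (ε / 3) (by positivity)
  refine ⟨N, fun j hj => ?_⟩
  have hsub : Icc t (t + h) ⊆ Icc t (t + η) := Icc_subset_Icc le_rfl (by linarith)
  have h1 : ‖h⁻¹ • (φ j (t + h) - φ j t) - deriv (φ j) t‖ ≤ K * h :=
    norm_slope_sub_deriv_le hh0 (fun s hs => hdφ j s (hsub hs)) (fun s hs => hKφ j s (hsub hs))
  have h2 : ‖h⁻¹ • (ψ (t + h) - ψ t) - deriv ψ t‖ ≤ K * h :=
    norm_slope_sub_deriv_le hh0 (fun s hs => hdψ s (hsub hs)) (fun s hs => hKψ s (hsub hs))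
  have h3 := hN j hj
  rw [dist_eq_norm] at h3 ⊢
  calc ‖deriv (φ j) t - deriv ψ t‖
      = ‖(h⁻¹ • (ψ (t + h) - ψ t) - deriv ψ t) - (h⁻¹ • (φ j (t + h) - φ j t) - deriv (φ j) t) +
          (h⁻¹ • (φ j (t + h) - φ j t) - h⁻¹ • (ψ (t + h) - ψ t))‖ := by
        congr 1; abel
    _ ≤ ‖h⁻¹ • (ψ (t + h) - ψ t) - deriv ψ t‖ + ‖h⁻¹ • (φ j (t + h) - φ j t) - deriv (φ j) t‖ +
          ‖h⁻¹ • (φ j (t + h) - φ j t) - h⁻¹ • (ψ (t + h) - ψ t)‖ :=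
        (norm_add_le _ _).trans (by gcongr; exact norm_sub_le _ _)
    _ < ε := by linarith

variable [FiniteDimensional ℝ E] [MeasurableSpace E] [BorelSpace E]

/-- The clock weight `e^{−‖x‖²/(4σ)}`, `σ > 0`, is integrable. -/
private theorem integrable_clockWeight {σ : ℝ} (hσ : 0 < σ) :
    Integrable (fun x : E => Real.exp (-(‖x‖ ^ 2) / (4 * σ))) := by
  refine (UnboundedOperators.integrable_gaussian_of_pos (E := E) (b := 1 / (4 * σ))
    (by positivity)).congr
    (Eventually.of_forall fun x => ?_)
  field_simp

section Slice

variable (hTD : ∀ (C a b : ℝ), a < b → b < 0 → ∃ K : ℝ,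
  ∀ u : ℝ → E → E, IsTypeIAncientMild C u →
    ∀ t ∈ Set.Icc a b, ∀ x : E,
      ‖timeDeriv u t x‖ ≤ K ∧ ‖iteratedDeriv 2 (fun s : ℝ => u s x) t‖ ≤ K)
include hTD

/-- **(i) Continuity of the clock amplitude** on `(−∞, 0)`, given the window bounds. -/
theorem clockAmp_continuousOn {C : ℝ} {u : ℝ → E → E} (hu : IsTypeIAncientMild C u) :
    ContinuousOn (fun t : ℝ => (-t) ^ ((3 : ℝ) / 2) *
      ∫ x, ‖timeDeriv u t x‖ ^ 2 * Real.exp (-(‖x‖ ^ 2) / (4 * (-t)))) (Set.Iio 0) := by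
  intro t₁ (ht₁ : t₁ < 0)
  refine ContinuousAt.continuousWithinAt (ContinuousAt.mul ?_ ?_)
  · exact continuous_neg.continuousAt.rpow_const (Or.inr (by norm_num))
  · -- the window `[a, b] = [3t₁/2, t₁/2] ∋ t₁`
    obtain ⟨K, hK⟩ := hTD C (t₁ + t₁ / 2) (t₁ / 2) (by linarith) (by linarith)
    have hwin : Ioo (t₁ + t₁ / 2) (t₁ / 2) ∈ 𝓝 t₁ := Ioo_mem_nhds (by linarith) (by linarith)
    refine continuousAt_of_dominated
      (bound := fun x => K ^ 2 * Real.exp (-(‖x‖ ^ 2) / (4 * -(t₁ + t₁ / 2)))) ?_ ?_ ?_ ?_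
    · filter_upwards [hwin] with t ht
      exact (continuous_clockIntegrand hu.contDiffOn (by linarith [ht.2]) (-t)).aestronglyMeasurable
    · filter_upwards [hwin] with t ht
      refine Eventually.of_forall fun x => ?_
      rw [Real.norm_of_nonneg (by positivity)]
      exact sq_mul_clockWeight_le ht.1.le (by linarith [ht.2])
        (hK u hu t ⟨ht.1.le, ht.2.le⟩ x).1 x
    · exact (integrable_clockWeight (by linarith)).const_mul _
    · refine Eventually.of_forall fun x => ?_
      have hne : (4 : ℝ) * -t₁ ≠ 0 := by nlinarith
      have hg : ContinuousAt (fun t : ℝ => 4 * -t) t₁ := by fun_prop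
      have hw : ContinuousAt (fun t : ℝ => Real.exp (-(‖x‖ ^ 2) / (4 * -t))) t₁ :=
        ((continuousAt_const (y := -(‖x‖ ^ 2))).div hg hne).rexp
      exact ((continuousAt_timeDeriv_curve hu.contDiffOn ht₁ x).norm.pow 2).mul hw

/-- **(ii) A zero of the clock is a steady instant**: `a_u(t) = 0`, `t < 0`, forces
`∂ₜu(t, ·) ≡ 0`, given the window bounds (which make the integrand integrable). -/
theorem timeDeriv_eq_zero_of_clockAmp_eq_zero
    {C : ℝ} {u : ℝ → E → E} (hu : IsTypeIAncientMild C u) {t : ℝ} (ht : t < 0)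
    (h0 : (-t) ^ ((3 : ℝ) / 2) *
      ∫ x, ‖timeDeriv u t x‖ ^ 2 * Real.exp (-(‖x‖ ^ 2) / (4 * (-t))) = 0) (x : E) :
    timeDeriv u t x = 0 := by
  have hpos : 0 < (-t) ^ ((3 : ℝ) / 2) := Real.rpow_pos_of_pos (by linarith) _
  have hint : ∫ x, ‖timeDeriv u t x‖ ^ 2 * Real.exp (-(‖x‖ ^ 2) / (4 * (-t))) = 0 :=
    (mul_eq_zero.1 h0).resolve_left hpos.ne'
  obtain ⟨K, hK⟩ := hTD C (t + t) t (by linarith) ht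
  have hfc : Continuous fun x : E => ‖timeDeriv u t x‖ ^ 2 * Real.exp (-(‖x‖ ^ 2) / (4 * (-t))) :=
    continuous_clockIntegrand hu.contDiffOn ht (-t)
  have hfn : 0 ≤ fun x : E => ‖timeDeriv u t x‖ ^ 2 * Real.exp (-(‖x‖ ^ 2) / (4 * (-t))) :=
    fun x => by positivity
  have hfi : Integrable fun x : E =>
      ‖timeDeriv u t x‖ ^ 2 * Real.exp (-(‖x‖ ^ 2) / (4 * (-t))) := by
    refine Integrable.mono' ((integrable_clockWeight (by linarith : (0 : ℝ) < -(t + t))).const_mul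
      (K ^ 2)) hfc.aestronglyMeasurable (Eventually.of_forall fun x => ?_)
    rw [Real.norm_of_nonneg (hfn x)]
    exact sq_mul_clockWeight_le (by linarith) ht (hK u hu t ⟨by linarith, le_rfl⟩ x).1 x
  have hae := (integral_eq_zero_iff_of_nonneg hfn hfi).1 hint
  have hzero := (hfc.ae_eq_iff_eq volume continuous_const).1 hae
  have hx : ‖timeDeriv u t x‖ ^ 2 * Real.exp (-(‖x‖ ^ 2) / (4 * (-t))) = 0 := congr_fun hzero x
  have h2 : ‖timeDeriv u t x‖ ^ 2 = 0 := (mul_eq_zero.1 hx).resolve_right (Real.exp_pos _).ne'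
  exact norm_eq_zero.1 ((pow_eq_zero_iff two_ne_zero).1 h2)

/-- **(iii) Convergence of clock amplitudes** along pointwise-convergent sequences of the class
with one constant, given the window bounds. -/
theorem clockAmp_tendsto {C : ℝ} {w : ℕ → ℝ → E → E} {W : ℝ → E → E}
    (hw : ∀ j, IsTypeIAncientMild C (w j)) (hW : IsTypeIAncientMild C W)
    (hlim : ∀ t < 0, ∀ x, Tendsto (fun j => w j t x) atTop (𝓝 (W t x))) {t : ℝ} (ht : t < 0) :
    Tendsto (fun j => (-t) ^ ((3 : ℝ) / 2) *
        ∫ x, ‖timeDeriv (w j) t x‖ ^ 2 * Real.exp (-(‖x‖ ^ 2) / (4 * (-t)))) atTop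
      (𝓝 ((-t) ^ ((3 : ℝ) / 2) *
        ∫ x, ‖timeDeriv W t x‖ ^ 2 * Real.exp (-(‖x‖ ^ 2) / (4 * (-t))))) := by
  refine Tendsto.const_mul _ ?_
  -- the window `[t, t/2]`
  obtain ⟨K, hK⟩ := hTD C t (t + -t / 2) (by linarith) (by linarith)
  refine tendsto_integral_of_dominated_convergence
    (fun x => K ^ 2 * Real.exp (-(‖x‖ ^ 2) / (4 * -t))) ?_ ?_ ?_ ?_
  · exact fun j => (continuous_clockIntegrand (hw j).contDiffOn ht (-t)).aestronglyMeasurable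
  · exact (integrable_clockWeight (by linarith)).const_mul _
  · refine fun j => Eventually.of_forall fun x => ?_
    rw [Real.norm_of_nonneg (by positivity)]
    exact sq_mul_clockWeight_le le_rfl ht (hK (w j) (hw j) t ⟨le_rfl, by linarith⟩ x).1 x
  · refine Eventually.of_forall fun x => ?_
    have hd : Tendsto (fun j => timeDeriv (w j) t x) atTop (𝓝 (timeDeriv W t x)) := by
      simp only [timeDeriv_apply]
      exact tendsto_deriv_of_tendsto (φ := fun j s => w j s x) (ψ := fun s => W s x)
        (by linarith : (0 : ℝ) < -t / 2)
        (fun j s hs => hasDerivAt_curve (hw j).contDiffOn x (by linarith [hs.2]))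
        (fun s hs => hasDerivAt_curve hW.contDiffOn x (by linarith [hs.2]))
        (fun j s hs => (hK (w j) (hw j) s hs x).2) (fun s hs => (hK W hW s hs x).2)
        (fun s hs => hlim s (by linarith [hs.2]) x)
    exact (hd.norm.pow 2).mul_const _

end Slice

/-- **(iv) Parabolic covariance of the clock amplitude** on `ℝ³` under the zoom
`u_c(s,y) = c u(c²s, cy)`: `a_{u_c}(s) = a_u(c² s)` (chain rule `∂ₛu_c(s,y) = c³ ∂ₜu(c²s, cy)`,
substitution `x = c y`, `(c²)^{3/2} = c³`). -/
theorem clockAmp_zoom (u : ℝ → EuclideanSpace ℝ (Fin 3) → EuclideanSpace ℝ (Fin 3)) {c : ℝ}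
    (hc : 0 < c) {s : ℝ} (hs : s < 0) :
    (-s) ^ ((3 : ℝ) / 2) *
        ∫ y, ‖timeDeriv (c • stPull (c ^ 2) c 0 0 u) s y‖ ^ 2 *
          Real.exp (-(‖y‖ ^ 2) / (4 * (-s))) =
      (-(c ^ 2 * s)) ^ ((3 : ℝ) / 2) *
        ∫ x, ‖timeDeriv u (c ^ 2 * s) x‖ ^ 2 * Real.exp (-(‖x‖ ^ 2) / (4 * (-(c ^ 2 * s)))) := by
  -- chain rule (unconditional: both sides are junk `0` together)
  have hderiv : ∀ y, timeDeriv (c • stPull (c ^ 2) c 0 0 u) s y =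
      (c * c ^ 2) • timeDeriv u (c ^ 2 * s) (c • y) := by
    intro y
    have e1 : timeDeriv (c • stPull (c ^ 2) c 0 0 u) s y =
        c • timeDeriv (stPull (c ^ 2) c 0 0 u) s y := by
      simp only [timeDeriv_apply, Pi.smul_apply]
      exact deriv_fun_const_smul_field c _
    rw [e1, timeDeriv_stPull, zero_add, zero_add, smul_smul]
  set G := fun x => ‖timeDeriv u (c ^ 2 * s) x‖ ^ 2 *
    Real.exp (-(‖x‖ ^ 2) / (4 * (-(c ^ 2 * s)))) with hG
  have hpt : ∀ y, ‖timeDeriv (c • stPull (c ^ 2) c 0 0 u) s y‖ ^ 2 *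
      Real.exp (-(‖y‖ ^ 2) / (4 * (-s))) = c ^ 6 * G (0 + c • y) := by
    intro y
    rw [zero_add, hderiv, norm_smul, hG]
    dsimp only
    rw [norm_smul, Real.norm_of_nonneg hc.le,
      Real.norm_of_nonneg (by positivity : (0 : ℝ) ≤ c * c ^ 2)]
    have hs0 : s ≠ 0 := hs.ne
    have e : -((c * ‖y‖) ^ 2) / (4 * -(c ^ 2 * s)) = -(‖y‖ ^ 2) / (4 * -s) := by
      field_simp
    rw [e]
    ring
  have hI : ∫ y, ‖timeDeriv (c • stPull (c ^ 2) c 0 0 u) s y‖ ^ 2 *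
      Real.exp (-(‖y‖ ^ 2) / (4 * (-s))) = ∫ y, c ^ 6 * G (0 + c • y) :=
    integral_congr_ae (Eventually.of_forall hpt)
  rw [hI, integral_const_mul, integral_comp_space_affine hc 0 G, finrank_euclideanSpace_fin,
    smul_eq_mul]
  have hr : (-(c ^ 2 * s)) ^ ((3 : ℝ) / 2) = c ^ 3 * (-s) ^ ((3 : ℝ) / 2) := by
    rw [show -(c ^ 2 * s) = c ^ 2 * -s by ring, Real.mul_rpow (by positivity) (by linarith)]
    congr 1
    rw [← Real.rpow_natCast c 2, ← Real.rpow_mul hc.le, ← Real.rpow_natCast c 3]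
    norm_num
  have hc3 : c ^ 3 ≠ 0 := by positivity
  rw [hr, ← mul_assoc, ← mul_assoc,
    show (-s) ^ ((3 : ℝ) / 2) * c ^ 6 = c ^ 3 * (-s) ^ ((3 : ℝ) / 2) * c ^ 3 by ring,
    mul_inv_cancel_right₀ hc3]

/-- **Stub `stub_clockSlice` of line `birth` (crux `ClockStretchingLaw.ClockLaw`).** Given the
universal window bounds on `∂ₜu`, `∂ₜ²u` for Type-I KNSS-mild fields on `ℝ³`: (i) continuity on
`(−∞,0)` of `t ↦ (−t)^{3/2}∫‖∂ₜu(t,x)‖² e^{−‖x‖²/(4(−t))}dx`; (ii) a zero of it at `t < 0` forces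
`∂ₜu(t,·) ≡ 0`; (iii) convergence of the amplitudes along pointwise-convergent sequences in the
class; (iv) parabolic covariance under the zoom `c • stPull (c²) c 0 0 u`. -/
theorem stub_clockSlice :
    (∀ (C a b : ℝ), a < b → b < 0 → ∃ K : ℝ,
      ∀ u : ℝ → EuclideanSpace ℝ (Fin 3) → EuclideanSpace ℝ (Fin 3), IsTypeIAncientMild C u →
        ∀ t ∈ Set.Icc a b, ∀ x : EuclideanSpace ℝ (Fin 3),
          ‖timeDeriv u t x‖ ≤ K ∧ ‖iteratedDeriv 2 (fun s : ℝ => u s x) t‖ ≤ K) →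
    (∀ (C : ℝ) (u : ℝ → EuclideanSpace ℝ (Fin 3) → EuclideanSpace ℝ (Fin 3)),
        IsTypeIAncientMild C u →
        ContinuousOn (fun t : ℝ => (-t) ^ ((3 : ℝ) / 2) *
          ∫ x, ‖timeDeriv u t x‖ ^ 2 * Real.exp (-(‖x‖ ^ 2) / (4 * (-t)))) (Set.Iio 0)) ∧
    (∀ (C : ℝ) (u : ℝ → EuclideanSpace ℝ (Fin 3) → EuclideanSpace ℝ (Fin 3)),
        IsTypeIAncientMild C u →
        ∀ t < 0, (-t) ^ ((3 : ℝ) / 2) *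
          ∫ x, ‖timeDeriv u t x‖ ^ 2 * Real.exp (-(‖x‖ ^ 2) / (4 * (-t))) = 0 →
          ∀ x, timeDeriv u t x = 0) ∧
    (∀ (C : ℝ) (w : ℕ → ℝ → EuclideanSpace ℝ (Fin 3) → EuclideanSpace ℝ (Fin 3))
        (W : ℝ → EuclideanSpace ℝ (Fin 3) → EuclideanSpace ℝ (Fin 3)),
        (∀ j, IsTypeIAncientMild C (w j)) → IsTypeIAncientMild C W →
        (∀ t < 0, ∀ x, Tendsto (fun j => w j t x) atTop (𝓝 (W t x))) →
        ∀ t < 0, Tendsto (fun j => (-t) ^ ((3 : ℝ) / 2) *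
            ∫ x, ‖timeDeriv (w j) t x‖ ^ 2 * Real.exp (-(‖x‖ ^ 2) / (4 * (-t)))) atTop
          (𝓝 ((-t) ^ ((3 : ℝ) / 2) *
            ∫ x, ‖timeDeriv W t x‖ ^ 2 * Real.exp (-(‖x‖ ^ 2) / (4 * (-t)))))) ∧
    (∀ (C : ℝ) (u : ℝ → EuclideanSpace ℝ (Fin 3) → EuclideanSpace ℝ (Fin 3)),
        IsTypeIAncientMild C u →
        ∀ c : ℝ, 0 < c → ∀ s < 0,
          (-s) ^ ((3 : ℝ) / 2) *
              ∫ y, ‖timeDeriv (c • stPull (c ^ 2) c 0 0 u) s y‖ ^ 2 *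
                Real.exp (-(‖y‖ ^ 2) / (4 * (-s))) =
            (-(c ^ 2 * s)) ^ ((3 : ℝ) / 2) *
              ∫ x, ‖timeDeriv u (c ^ 2 * s) x‖ ^ 2 *
                Real.exp (-(‖x‖ ^ 2) / (4 * (-(c ^ 2 * s))))) := by
  intro hTD
  refine ⟨fun C u hu => clockAmp_continuousOn hTD hu,
    fun C u hu t ht h0 x => timeDeriv_eq_zero_of_clockAmp_eq_zero hTD hu ht h0 x,
    fun C w W hw hW hlim t ht => clockAmp_tendsto hTD hw hW hlim ht,
    fun C u _ c hc s hs => clockAmp_zoom u hc hs⟩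

end Summit.NavierStokesRegularity.NavierStokesRegularity.Theorems.ClockLaw.Birth

end
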